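import Summits.ResolutionOfSingularities.ResolutionOfSingularities.Theorems.EquisingularLiftEquisingularLiftNatOneStepVertexChartRel
import Summits.ResolutionOfSingularities.ResolutionOfSingularities.Theorems.EquisingularLiftEquisingularLiftNatOneStepPoints
import HarnessLib

/-!
# [OURS · L1 W4.5(b)] ONE-STEP LINEAR CENTRES, ANY DIMENSION: the chart `(ChartRing F c)[I_c/(x_a/x_c)]` of the blow-up of a hypersurface along a
# coordinate `ℙʳ`, regular along the exceptional divisor from the explicit strict transform over the base `K[u]` of surviving variables
# (crux `Theses.EquisingularLift.EquisingularLiftNat`, stmt-ResolutionOfSingularities-20038)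

NOT a statement of any manuscript; OURS kernel plumbing (cell `res-hironaka`, chain w45b; seat res-D-pv-013, own initiative, counted 0). AI-written,
weaker than expert review. No definition, no `sorry`, standard axioms.

The line version of `OneStep.isRegularLocalRing_localization_blowupAlgebra_chartRing` (p561858): the centre is the coordinate `ℙʳ = V(x_a : a ∉ range e)`
(`e` the surviving coordinates, `c ∈ range e` a chart), and the chart variables `y_j = x_{c.succAbove j}/x_c` split into CONE variables
(`c.succAbove j ∉ range e`) and SURVIVING ones. The splitting is given as a ring isomorphism `ρ : K[y] ≃ R[z₀,…,z_M]` over ANY domain `R` (in applications `R = K[u]`, the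
surviving variables), sending the cone variables onto the `z`'s — for specimens `ρ` is a `renameEquiv` followed by Mathlib's `sumAlgEquiv`. Then:

* **`OneStepLine.isRegularLocalRing_localization_blowupAlgebra_chartRing`** — if `ρ(F(x_c := 1)) = Φ + Ψ` with `Φ ≠ 0` homogeneous of degree `μ` in `z`
  (coefficients in `R`), `Ψ ∈ (z)^{μ+1}`, and for every chart direction `l` an explicit strict transform `G_l` ((`Φ+Ψ)(T_l, T_lT_j) = T_l^μ·G_l`) with
  `R[T]/(G_l)` regular at the primes containing `T̄_l` (e.g. by `OneStepRel.isRegularLocalRing_localization_quotient_of_pderiv_ringEquiv`), then the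
  localisations of `(ChartRing F c)[I_c/(x_a/x_c)]` (`I_c = (x_{a'}/x_c : a' ∉ range e)`, `a ∉ range e`) at the primes containing `x_a/x_c` are regular
  — `OneStepRel.isRegularLocalRing_localization_blowupAlgebra` (p565718) transported along `ChartRing F c ≅ K[y]/(f) ≅ R[z]/(Φ + Ψ)`.

This is exactly the `hon` input of `HypersurfaceSpecimen.isRegularLocalRing_stalk_of_isBlowup_comap_of_mem_support` (p551698, any `e`): the route to
EL♮ for hypersurfaces with one-step LINEAR singular loci (pinch points; the Whitney umbrella `x₀x₁² − x₂²x₃`).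

References: Görtz–Wedhorn I Prop. 13.96; The Stacks Project 0804, 0BIQ — through the cited tree files.
-/

set_option linter.dupNamespace false -- mandated namespace `Summit.<Summit>.<Problem>` of this single-conjunct summit

noncomputable section

open CategoryTheory AlgebraicGeometry
open MvPolynomial HomogeneousLocalization
open Literature.AlgebraicGeometry.Resolution
open Literature.AlgebraicGeometry.Motives Literature.AlgebraicGeometry.Motives.SmoothHypersurface
open Literature.AlgebraicGeometry.Motives.ProjectiveSpace

namespace Summit.ResolutionOfSingularities.ResolutionOfSingularities.Cruxes.EquisingularLiftNat.Sections

namespace OneStepLine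

variable (k : Type) [Field k] {m : ℕ} (F : MvPolynomial (Fin (m + 2 + 1)) k) {d : ℕ} (hF : F.IsHomogeneous d) (c : Fin (m + 2 + 1))
  {r : ℕ} (e : Fin (r + 1) → Fin (m + 2 + 1))
  {M : ℕ} (R : Type) [CommRing R] [IsDomain R] (ρ : MvPolynomial (Fin (m + 2)) k ≃+* MvPolynomial (Fin (M + 1)) R)
  (hρ₁ : ∀ j : Fin (m + 2), c.succAbove j ∉ Set.range e → ∃ i : Fin (M + 1), ρ (X j) = X i)
  (hρ₂ : ∀ i : Fin (M + 1), ∃ j : Fin (m + 2), c.succAbove j ∉ Set.range e ∧ ρ (X j) = X i)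

attribute [local instance] MvPolynomial.gradedAlgebra ProjBaseChange.algebraBase

include hρ₁ hρ₂ in
/-- **THE CHART OF A ONE-STEP LINEAR CENTRE, on `ChartRing F c`** (any `n`, any surviving set `e`, chart `c ∈ range e`). See the module docstring.
[cite: GortzWedhorn2020, Prop. 13.96] [cite: StacksProject, Tag 0BIQ] -/
theorem isRegularLocalRing_localization_blowupAlgebra_chartRing (hc : c ∈ Set.range e)
    (f : MvPolynomial (Fin (m + 2)) k) (hdeh : dehomogenize k c F = f) (hrad : (Ideal.span {f}).radical = Ideal.span {f})
    (Φ Ψ : MvPolynomial (Fin (M + 1)) R) {μ : ℕ} (hΦ : Φ.IsHomogeneous μ) (hΦ0 : Φ ≠ 0)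
    (hΨ : Ψ ∈ Ideal.span (Set.range (X : Fin (M + 1) → MvPolynomial (Fin (M + 1)) R)) ^ (μ + 1)) (hρf : ρ f = Φ + Ψ)
    (hone : ∀ l : Fin (M + 1), ∃ G : MvPolynomial (Fin (M + 1)) R,
      aeval (fun j => X l * Function.update (X : Fin (M + 1) → MvPolynomial (Fin (M + 1)) R) l 1 j) (Φ + Ψ) = X l ^ μ * G ∧
      ∀ (P : Ideal (MvPolynomial (Fin (M + 1)) R ⧸ Ideal.span {G})) [P.IsPrime],
        Ideal.Quotient.mk (Ideal.span {G}) (X l) ∈ P → IsRegularLocalRing (Localization.AtPrime P))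
    (a : {a : Fin (m + 2 + 1) // a ∉ Set.range e})
    (𝔐 : Ideal (blowupAlgebra (Ideal.span (Set.range fun a' : {a' : Fin (m + 2 + 1) // a' ∉ Set.range e} => tautVec F c hF a'.1))
      (tautVec F c hF a.1))) [𝔐.IsPrime]
    (h𝔐 : algebraMap (ChartRing F c hF) (blowupAlgebra (Ideal.span (Set.range fun a' : {a' : Fin (m + 2 + 1) // a' ∉ Set.range e} =>
      tautVec F c hF a'.1)) (tautVec F c hF a.1)) (tautVec F c hF a.1) ∈ 𝔐) :
    IsRegularLocalRing (Localization.AtPrime 𝔐) := by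
  obtain ⟨θ₀, hθ₀⟩ := HypersurfaceSpecimen.exists_chartQuotEquiv F hF c f hdeh hrad
  -- `ChartRing F c ≅ K[y]/(f) ≅ R[z]/(Φ + Ψ)`
  have hfmap : Ideal.span {Φ + Ψ} = (Ideal.span {f}).map (ρ : MvPolynomial (Fin (m + 2)) k →+* MvPolynomial (Fin (M + 1)) R) := by
    rw [Ideal.map_span, Set.image_singleton]
    exact congrArg (fun b => Ideal.span {b}) hρf.symm
  let ρbar : (MvPolynomial (Fin (m + 2)) k ⧸ Ideal.span {f}) ≃+* (MvPolynomial (Fin (M + 1)) R ⧸ Ideal.span {Φ + Ψ}) :=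
    Ideal.quotientEquiv _ _ ρ hfmap
  have hρbar : ∀ q, ρbar (Ideal.Quotient.mk _ q) = Ideal.Quotient.mk _ (ρ q) := fun q => Ideal.quotientEquiv_mk _ _ _ _ q
  let θ := θ₀.trans ρbar
  have hac : a.1 ≠ c := fun h => a.2 (h ▸ hc)
  obtain ⟨j₀, hj₀⟩ : ∃ j : Fin (m + 2), c.succAbove j = a.1 := Fin.exists_succAbove_eq hac
  have hj₀e : c.succAbove j₀ ∉ Set.range e := by rw [hj₀]; exact a.2
  obtain ⟨l₀, hl₀⟩ := hρ₁ j₀ hj₀e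
  -- the centre and the generator under `θ`
  have hθgen : ∀ a' : {a' : Fin (m + 2 + 1) // a' ∉ Set.range e}, ∃ i : Fin (M + 1),
      θ (tautVec F c hF a'.1) = Ideal.Quotient.mk (Ideal.span {Φ + Ψ}) (X i) := by
    rintro ⟨a', ha'⟩
    have ha'c : a' ≠ c := fun h => ha' (h ▸ hc)
    obtain ⟨j, rfl⟩ : ∃ j : Fin (m + 2), c.succAbove j = a' := Fin.exists_succAbove_eq ha'c
    obtain ⟨i, hi⟩ := hρ₁ j ha'
    refine ⟨i, ?_⟩
    change ρbar (θ₀ (tautVec F c hF (c.succAbove j))) = _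
    rw [hθ₀ j, hρbar, hi]
  have hrange : Set.range (⇑θ.toRingHom ∘ fun a' : {a' : Fin (m + 2 + 1) // a' ∉ Set.range e} => tautVec F c hF a'.1) =
      Set.range (⇑(Ideal.Quotient.mk (Ideal.span {Φ + Ψ})) ∘ (MvPolynomial.X : Fin (M + 1) → MvPolynomial (Fin (M + 1)) R)) := by
    ext q
    constructor
    · rintro ⟨a', rfl⟩
      obtain ⟨i, hi⟩ := hθgen a'
      exact ⟨i, hi.symm⟩
    · rintro ⟨i, rfl⟩
      obtain ⟨j, hje, hji⟩ := hρ₂ i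
      refine ⟨⟨c.succAbove j, hje⟩, ?_⟩
      change ρbar (θ₀ (tautVec F c hF (c.succAbove j))) = _
      rw [hθ₀ j, hρbar, hji]
      rfl
  have hIθ : (Ideal.span (Set.range fun a' : {a' : Fin (m + 2 + 1) // a' ∉ Set.range e} => tautVec F c hF a'.1)).map θ.toRingHom =
      (Ideal.span (Set.range (X : Fin (M + 1) → MvPolynomial (Fin (M + 1)) R))).map (Ideal.Quotient.mk (Ideal.span {Φ + Ψ})) := by
    rw [Ideal.map_span, Ideal.map_span, ← Set.range_comp, hrange, Set.range_comp]
  have hbθ : θ (tautVec F c hF a.1) = Ideal.Quotient.mk (Ideal.span {Φ + Ψ}) (X l₀) := by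
    rw [← hj₀]
    change ρbar (θ₀ (tautVec F c hF (c.succAbove j₀))) = _
    rw [hθ₀ j₀, hρbar, hl₀]
  -- the vertex chart statement over the base `R = K[u]`, for arbitrary indices equal to the transported ones
  have key : ∀ (J : Ideal (MvPolynomial (Fin (M + 1)) R ⧸ Ideal.span {Φ + Ψ}))
      (b : MvPolynomial (Fin (M + 1)) R ⧸ Ideal.span {Φ + Ψ}),
      J = (Ideal.span (Set.range (X : Fin (M + 1) → MvPolynomial (Fin (M + 1)) R))).map (Ideal.Quotient.mk (Ideal.span {Φ + Ψ})) →
      b = Ideal.Quotient.mk (Ideal.span {Φ + Ψ}) (X l₀) →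
      ∀ (𝔑 : Ideal (blowupAlgebra J b)) [𝔑.IsPrime], algebraMap _ (blowupAlgebra J b) b ∈ 𝔑 →
        IsRegularLocalRing (Localization.AtPrime 𝔑) := by
    rintro J b rfl rfl 𝔑 _ h𝔑
    obtain ⟨G, hG, hregG⟩ := hone l₀
    exact OneStepRel.isRegularLocalRing_localization_blowupAlgebra R Φ Ψ hΦ hΦ0 hΨ l₀ G hG
      (fun P _ hP => hregG P hP) 𝔑 h𝔑
  -- transport along `congrEquiv θ`
  let η := blowupAlgebra.congrEquiv θ (Ideal.span (Set.range fun a' : {a' : Fin (m + 2 + 1) // a' ∉ Set.range e} => tautVec F c hF a'.1))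
    (tautVec F c hF a.1)
  obtain ⟨𝔑, h𝔑⟩ : ∃ P, P = 𝔐.comap η.symm.toRingHom := ⟨_, rfl⟩
  haveI : 𝔑.IsPrime := by rw [h𝔑]; exact Ideal.comap_isPrime _ 𝔐
  have h𝔑mem : algebraMap _ (blowupAlgebra ((Ideal.span (Set.range fun a' : {a' : Fin (m + 2 + 1) // a' ∉ Set.range e} =>
      tautVec F c hF a'.1)).map θ.toRingHom) (θ (tautVec F c hF a.1))) (θ (tautVec F c hF a.1)) ∈ 𝔑 := by
    rw [h𝔑, Ideal.mem_comap]
    change η.symm _ ∈ 𝔐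
    rw [blowupAlgebra.congrEquiv_symm_algebraMap, RingEquiv.symm_apply_apply]
    exact h𝔐
  have hreg := key _ _ hIθ hbθ 𝔑 h𝔑mem
  exact OrdPoint.isRegularLocalRing_localization_of_ringEquiv
    (C := blowupAlgebra ((Ideal.span (Set.range fun a' : {a' : Fin (m + 2 + 1) // a' ∉ Set.range e} => tautVec F c hF a'.1)).map
      θ.toRingHom) (θ (tautVec F c hF a.1)))
    (D := blowupAlgebra (Ideal.span (Set.range fun a' : {a' : Fin (m + 2 + 1) // a' ∉ Set.range e} => tautVec F c hF a'.1))
      (tautVec F c hF a.1)) η.symm 𝔑 𝔐 (fun y => by rw [h𝔑, Ideal.mem_comap]; rfl) hreg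

end OneStepLine

end Summit.ResolutionOfSingularities.ResolutionOfSingularities.Cruxes.EquisingularLiftNat.Sections

end
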